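import Literature.AlgebraicGeometry.Motives.TateClassesFrobeniusPowerFixed
import Literature.GroupTheory.TopologicallyCyclicIndex
import Literature.RepresentationTheory.FiniteGroups.TracePowCharpoly
import HarnessLib

/-!
# `Γ_k` acts on the Tate classes through the finite cyclic quotient generated by the Frobenius:
# `𝒯ᵖ(X) ∩ Ker(φ_p − 1) = H^{2p}(X)(p)^Γ`, `𝒯ᵖ(X) = H^{2p}(X)(p)^U`, and the Frobenius is
# semisimple on `𝒯ᵖ(X)` («`S^p` holds on the Tate classes»)

Topic `Literature/AlgebraicGeometry/Motives`; THEOREMS ONLY (no definition, no instance, no named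
fact; D-0026).

J. S. Milne, *The Tate conjecture over finite fields* (AIM talk, arXiv:0709.3040 §1, held, p. 3)
describes the Tate classes of a variety over `𝔽` with the FROBENIUS and the MODELS over finite fields:
«`H^{2r}(X, ℚ_ℓ(r))' := ⋃_{X₁/k₁} H^{2r}(X, ℚ_ℓ(r))^{Gal(𝔽/k₁)}`», «The conjecture implies that, for any
model `X₁/k₁`, the `ℚ_ℓ`-subspace `H^{2r}(X, ℚ_ℓ(r))^{Gal(𝔽/k₁)}` is spanned by the classes of algebraic
cycles on `X₁`», «If `π₁` and `π₂` are `p^{n₁}`- and `p^{n₂}`-Frobenius maps of `X`, then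
`π₁^{n₂N} = π₂^{n₁N}` for some `N > 1`», and «Conjecture `S^r(X, ℓ)` (Partial semisimplicity). Every
Frobenius map `π` of `X` acts semisimply on `H^{2r}(X, ℚ_ℓ(r))₁` (i.e., it acts as `1`)», whereas
J. Tate (*Conjectures on algebraic cycles in ℓ-adic cohomology* (1994) §1) uses the classes fixed by an
OPEN SUBGROUP of `Γ_k` — the tree's `GaloisWeilCohomology.tateClasses E X p = smoothInvariants (E.ρTwist X (2p) p)`.
The bridge is that `Γ_k = Gal(k̄/k) ≅ Ẑ` is topologically generated by the Frobenius (J.-P. Serre,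
*Local Fields*, Ch. XIII §1; tree `denseRange_zpowers_arithFrob_holds`): modulo an open subgroup `U`,
`Γ_k/U` is the finite cyclic group generated by the class of the Frobenius.

For the tree's abstract `E : GaloisWeilCohomology k K χ` (NO continuity of `ρ`) over a finite field
`k` this file proves what this bridge gives ON THE TATE CLASSES, unconditionally:

* §1 (group theory of `Γ_k`, `k` finite) every `g ∈ Γ_k` is `F^r u` with `u` in a given open subgroup
  `U` and `0 ≤ r < [Γ_k : U]` (`exists_pow_geomFrob_mul_mem`), and **`F^r ∈ U ⟺ [Γ_k : U] ∣ r`**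
  (`geomFrob_pow_mem_iff_index_dvd`): `Γ_k/U` is cyclic of order `[Γ_k : U]` generated by `F`.
* §2 (representations `ρ` of `Γ_k` on a `K`-vector space, no topology on `V`) the smooth vectors are
  `Γ`-stable (`apply_mem_smoothInvariants`, any topological group); **a smooth vector fixed by the
  Frobenius is fixed by `Γ_k`**: `smoothInvariants ρ ∩ Ker(ρ(F) − 1) = V^Γ`
  (`smoothInvariants_inf_ker_sub_one_eq_invariants`); Milne's «`H^{Gal(𝔽/k₁)}`» inside the smooth
  vectors: **`V^U = smoothInvariants ρ ∩ Ker(ρ(F)^{[Γ:U]} − 1)`** (`invariants_openSubgroup_eq_smoothInvariants_inf_ker`);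
  `Γ_k` acts on `V^U` through the powers `ρ(F)^r`, `r < [Γ_k : U]`
  (`exists_lt_index_forall_apply_eq_pow_apply`), every `ρ(g)^{[Γ:U]}` is the identity on `V^U`, hence
  (char `K` = 0) **every `ρ(g)` is a semisimple endomorphism of any `ρ(g)`-stable `T ≤ V^U`**
  (`isSemisimple_restrict_of_le_invariants`, via the tree's `TracePow.isSemisimple_of_pow_eq_one`).
* §3 (Tate classes of `E`) `Γ_k`-stability `ρTwist_apply_mem_tateClasses` (any `k`); ONE open
  subgroup with **`𝒯ᵖ(X) = H^{2p}(X)(p)^U`** (`exists_openSubgroup_tateClasses_eq_invariants`, any `k`,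
  `X` smooth projective: finite dimension); over a finite field **`𝒯ᵖ(X) ∩ Ker(φ_p − 1) = H^Γ`**
  (`tateClasses_inf_ker_sub_one_eq_invariants`) — so the tree's `T^p(X)` (`K·Aᵖ = H^Γ`) is MILNE'S
  «the Tate classes fixed by the Frobenius of the model are algebraic»
  (`tateConjectureFor_iff_forall_mem_tateClasses`), `H^{2p}(p)^U = 𝒯ᵖ ∩ Ker(φ_p^{[Γ:U]} − 1)`
  (`invariants_openSubgroup_eq_tateClasses_inf_ker`), and **`Γ_k` acts on `𝒯ᵖ(X)` through the finite
  cyclic group generated by `φ_p`**: one `N ≥ 1` with `φ_p^N = 1` on `𝒯ᵖ(X)` and every `ρ(g)|𝒯 = φ_p^r|𝒯`,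
  `r < N` (`exists_forall_ρTwist_apply_eq_pow_apply`).
* §4 (semisimplicity, char `K` = 0) **the twisted Frobenius `φ_p`, indeed every `χ(g)ᵖρ(g)`, is a
  SEMISIMPLE endomorphism of `𝒯ᵖ(X)`** (`isSemisimple_restrict_ρTwist_tateClasses`); its eigenvalues on
  Tate classes are roots of unity (`pow_eq_one_of_apply_eq_smul_of_mem_tateClasses`); and MILNE'S `S^p`
  HOLDS ON THE TATE CLASSES: **`𝒯ᵖ(X) ∩ H^{2p}(X)(p)₁ = H^Γ = 𝒯ᵖ(X) ∩ Ker(φ_p − 1)`**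
  (`tateClasses_inf_maxGenEigenspace_one_eq_invariants`) and `Ker(φ_p − 1) ∩ (φ_p − 1)𝒯ᵖ(X) = 0`
  (`ker_sub_one_inf_map_tateClasses_eq_bot`).

What this file does NOT do: nothing is said about classes OUTSIDE `𝒯ᵖ(X)` — `Ker(φ_p − 1) ⊆ 𝒯ᵖ(X)`,
`S^p` and `SS` on all of `H^{2p}(X)(p)` need continuity of `ρ` (gen-38 file
`TateConjectureFrobeniusVersusGaloisForms` keeps them as hypotheses); `T^p` is not proved in any case.
HC is not touched.

## Provenance

Lane `lit-hodgefound` (summit `HodgeConjecture`, Track 2 foundations library, Layer B: motives),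
seat `lit-hodgefound-p29` (literature-prover, generation 39, row g39-#1).
-/

universe u v w

open CategoryTheory AlgebraicGeometry

noncomputable section

namespace Literature.AlgebraicGeometry.Motives

/-! ## §1 `Γ_k` modulo an open subgroup: finite cyclic, generated by the Frobenius -/

section GroupTheory

variable {k : Type u} [Field k] [Finite k]

/-- The powers of the GEOMETRIC Frobenius are dense in `Γ_k = Gal(k̄/k)`, `k` finite (the tree's
`denseRange_zpowers_arithFrob_holds` for `F = (arith. Frobenius)⁻¹`; `⟨F⟩ = ⟨F⁻¹⟩`).
[cite: SerreLocalFields1979, Ch. XIII §1] -/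
theorem dense_zpowers_geomFrob :
    Dense ((Subgroup.zpowers (geomFrob k) : Subgroup (Field.absoluteGaloisGroup k)) :
      Set (Field.absoluteGaloisGroup k)) := by
  rw [geomFrob, Subgroup.zpowers_inv, Subgroup.coe_zpowers]
  exact denseRange_zpowers_arithFrob_holds (k := k)

/-- Every subgroup of `Γ_k`, `k` finite, is normal (`Γ_k` is abelian, row g38-#11
`absoluteGaloisGroup_mul_comm`). [cite: SerreLocalFields1979, Ch. XIII §1] -/
theorem absoluteGaloisGroup_subgroup_normal (H : Subgroup (Field.absoluteGaloisGroup k)) : H.Normal :=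
  ⟨fun n hn g ↦ by rwa [absoluteGaloisGroup_mul_comm g n, mul_inv_cancel_right]⟩

/-- **Every class of `Γ_k` modulo an open subgroup is represented by a power of the geometric
Frobenius**: `g = Fⁿ u`, `n ∈ ℤ`, `u ∈ U` (the coset `gU` is open, the powers of `F` are dense).
[cite: SerreLocalFields1979, Ch. XIII §1] [cite: Milne2007TateFiniteFieldsAIM, §1] -/
theorem exists_zpow_geomFrob_mul_mem (U : OpenSubgroup (Field.absoluteGaloisGroup k))
    (g : Field.absoluteGaloisGroup k) :
    ∃ n : ℤ, ∃ u ∈ (U : Subgroup (Field.absoluteGaloisGroup k)), g = geomFrob k ^ n * u := by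
  haveI := absoluteGaloisGroup_subgroup_normal (U : Subgroup (Field.absoluteGaloisGroup k))
  obtain ⟨n, hn⟩ := Literature.GroupTheory.exists_zpow_quotient_eq_of_dense_zpowers
    dense_zpowers_geomFrob (U : Subgroup (Field.absoluteGaloisGroup k)) U.isOpen (QuotientGroup.mk g)
  rw [← QuotientGroup.mk_zpow, QuotientGroup.eq] at hn
  exact ⟨n, _, hn, (mul_inv_cancel_left _ _).symm⟩

/-- **`g = Fʳ u` with `0 ≤ r < [Γ_k : U]` and `u ∈ U`**, for every `g ∈ Γ_k` and every open subgroup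
`U` (`k` finite): reduce the exponent modulo the (finite) index, using `F^{[Γ:U]} ∈ U`.
[cite: SerreLocalFields1979, Ch. XIII §1] [cite: Milne2007TateFiniteFieldsAIM, §1] -/
theorem exists_pow_geomFrob_mul_mem (U : OpenSubgroup (Field.absoluteGaloisGroup k))
    (g : Field.absoluteGaloisGroup k) :
    ∃ r : ℕ, r < (U : Subgroup (Field.absoluteGaloisGroup k)).index ∧
      ∃ u ∈ (U : Subgroup (Field.absoluteGaloisGroup k)), g = geomFrob k ^ r * u := by
  obtain ⟨n, u, hu, rfl⟩ := exists_zpow_geomFrob_mul_mem U g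
  set N : ℕ := (U : Subgroup (Field.absoluteGaloisGroup k)).index with hN
  have hN0 : N ≠ 0 := index_ne_zero_of_openSubgroup U
  have hNpos : (0 : ℤ) < N := by exact_mod_cast Nat.pos_of_ne_zero hN0
  have h0 : 0 ≤ n % N := Int.emod_nonneg n hNpos.ne'
  have hlt : n % N < N := Int.emod_lt_of_pos n hNpos
  refine ⟨(n % N).toNat, by omega, geomFrob k ^ ((N : ℤ) * (n / N)) * u,
    (U : Subgroup (Field.absoluteGaloisGroup k)).mul_mem ?_ hu, ?_⟩
  · rw [zpow_mul, zpow_natCast]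
    exact Subgroup.zpow_mem _ (pow_index_mem_of_openSubgroup U _) _
  · rw [← mul_assoc, ← zpow_natCast, Int.toNat_of_nonneg h0, ← zpow_add, Int.emod_add_mul_ediv]

/-- **`Γ_k/U` is generated by the class of the geometric Frobenius** (`U` open, `k` finite).
[cite: SerreLocalFields1979, Ch. XIII §1] -/
theorem mem_zpowers_mk_geomFrob (U : OpenSubgroup (Field.absoluteGaloisGroup k))
    [(U : Subgroup (Field.absoluteGaloisGroup k)).Normal]
    (q : Field.absoluteGaloisGroup k ⧸ (U : Subgroup (Field.absoluteGaloisGroup k))) :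
    q ∈ Subgroup.zpowers
      (QuotientGroup.mk (geomFrob k) :
        Field.absoluteGaloisGroup k ⧸ (U : Subgroup (Field.absoluteGaloisGroup k))) := by
  obtain ⟨m, hm⟩ := Literature.GroupTheory.exists_zpow_quotient_eq_of_dense_zpowers
    dense_zpowers_geomFrob (U : Subgroup (Field.absoluteGaloisGroup k)) U.isOpen q
  exact Subgroup.mem_zpowers_iff.mpr ⟨m, hm⟩

/-- **The class of the Frobenius in `Γ_k/U` has order `[Γ_k : U]`** (`U` open, `k` finite): `Γ_k/U`
is the finite cyclic group it generates. [cite: SerreLocalFields1979, Ch. XIII §1]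
[cite: Milne2007TateFiniteFieldsAIM, §1 «π₁^{n₂N} = π₂^{n₁N}»] -/
theorem orderOf_mk_geomFrob (U : OpenSubgroup (Field.absoluteGaloisGroup k))
    [(U : Subgroup (Field.absoluteGaloisGroup k)).Normal] :
    orderOf (QuotientGroup.mk (geomFrob k) :
        Field.absoluteGaloisGroup k ⧸ (U : Subgroup (Field.absoluteGaloisGroup k))) =
      (U : Subgroup (Field.absoluteGaloisGroup k)).index := by
  rw [Subgroup.index_eq_card, orderOf_eq_card_of_forall_mem_zpowers (mem_zpowers_mk_geomFrob U)]

/-- **`Fʳ ∈ U ⟺ [Γ_k : U] ∣ r`** for an open subgroup `U` of `Γ_k`, `k` finite: the class of the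
Frobenius generates the cyclic group `Γ_k/U` of order `[Γ_k : U]`.  (Milne: the Frobenius map of the
model over the degree-`N` extension is `π^N`.) [cite: SerreLocalFields1979, Ch. XIII §1]
[cite: Milne2007TateFiniteFieldsAIM, §1] -/
theorem geomFrob_pow_mem_iff_index_dvd (U : OpenSubgroup (Field.absoluteGaloisGroup k)) (r : ℕ) :
    geomFrob k ^ r ∈ (U : Subgroup (Field.absoluteGaloisGroup k)) ↔
      (U : Subgroup (Field.absoluteGaloisGroup k)).index ∣ r := by
  haveI := absoluteGaloisGroup_subgroup_normal (U : Subgroup (Field.absoluteGaloisGroup k))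
  constructor
  · intro h
    rw [← orderOf_mk_geomFrob U]
    refine orderOf_dvd_of_pow_eq_one ?_
    rwa [← QuotientGroup.mk_pow, QuotientGroup.eq_one_iff]
  · rintro ⟨m, rfl⟩
    rw [pow_mul]
    exact Subgroup.pow_mem _ (pow_index_mem_of_openSubgroup U _) m

end GroupTheory

/-! ## §2 Representations of `Γ_k` without continuity: smooth vectors and the Frobenius -/

section Representations

variable {K : Type v} [Field K] {V : Type w} [AddCommGroup V] [Module K V]

/-- **The smooth vectors form a subrepresentation** (any topological group `Γ`, any representation,
no continuity): if `v` is fixed by the open subgroup `U` then `ρ(g)v` is fixed by the open subgroup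
`gUg⁻¹`. [cite: Tate1994, §1] -/
theorem apply_mem_smoothInvariants {Γ : Type*} [Group Γ] [TopologicalSpace Γ] [IsTopologicalGroup Γ]
    (ρ : Representation K Γ V) (g : Γ) {v : V} (hv : v ∈ smoothInvariants ρ) :
    ρ g v ∈ smoothInvariants ρ := by
  obtain ⟨U, hU⟩ := (mem_smoothInvariants_iff ρ v).mp hv
  have hc : Continuous (fun x : Γ ↦ (MulAut.conj g⁻¹).toMonoidHom x) := by
    simpa only [MulEquiv.coe_toMonoidHom, MulAut.conj_apply, inv_inv] using
      IsTopologicalGroup.continuous_conj g⁻¹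
  refine (mem_smoothInvariants_iff ρ _).mpr ⟨U.comap _ hc, fun x hx ↦ ?_⟩
  have hu : g⁻¹ * x * g ∈ U := by
    simpa only [OpenSubgroup.mem_comap, MulEquiv.coe_toMonoidHom, MulAut.conj_apply, inv_inv]
      using hx
  have hxg : x * g = g * (g⁻¹ * x * g) := by group
  rw [← Module.End.mul_apply, ← map_mul, hxg, map_mul, Module.End.mul_apply, hU _ hu]

variable {k : Type u} [Field k] [Finite k]

/-- Over a finite field every `ρ(g)` preserves the vectors fixed by an open subgroup `U`
(`Γ_k` is abelian). [cite: SerreLocalFields1979, Ch. XIII §1] [cite: Tate1994, §1] -/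
theorem apply_mem_invariants_openSubgroup (ρ : Representation K (Field.absoluteGaloisGroup k) V)
    (U : OpenSubgroup (Field.absoluteGaloisGroup k)) (g : Field.absoluteGaloisGroup k) {v : V}
    (hv : v ∈ Representation.invariants (ρ.comp (U : Subgroup (Field.absoluteGaloisGroup k)).subtype)) :
    ρ g v ∈ Representation.invariants (ρ.comp (U : Subgroup (Field.absoluteGaloisGroup k)).subtype) := by
  rw [Representation.mem_invariants] at hv ⊢
  rintro ⟨u, hu⟩
  have huv : ρ u v = v := hv ⟨u, hu⟩
  change ρ u (ρ g v) = ρ g v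
  rw [← Module.End.mul_apply, ← map_mul, absoluteGaloisGroup_mul_comm u g, map_mul,
    Module.End.mul_apply, huv]

/-- **A smooth vector fixed by the Frobenius is fixed by all of `Γ_k`** (`k` finite, NO continuity
of `ρ`): `v` is fixed by an open `U` and by `F`, and every `g` is `Fʳ u`.
[cite: Milne2007TateFiniteFieldsAIM, §1] [cite: SerreLocalFields1979, Ch. XIII §1] -/
theorem mem_invariants_of_mem_smoothInvariants_of_apply_eq
    (ρ : Representation K (Field.absoluteGaloisGroup k) V) {v : V} (hv : v ∈ smoothInvariants ρ)
    (hF : ρ (geomFrob k) v = v) : v ∈ ρ.invariants := by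
  obtain ⟨U, hU⟩ := (mem_smoothInvariants_iff ρ v).mp hv
  rw [Representation.mem_invariants]
  intro g
  obtain ⟨r, -, u, hu, rfl⟩ := exists_pow_geomFrob_mul_mem U g
  rw [map_mul, Module.End.mul_apply, hU u hu, map_pow, Module.End.pow_apply]
  exact Function.IsFixedPt.iterate hF r

/-- **`smoothInvariants ρ ∩ Ker(ρ(F) − 1) = V^{Γ_k}`** (`k` finite, no continuity): on the smooth
vectors «fixed by the Frobenius» and «fixed by the Galois group» agree.
[cite: Milne2007TateFiniteFieldsAIM, §1] [cite: Tate1994, §1] -/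
theorem smoothInvariants_inf_ker_sub_one_eq_invariants
    (ρ : Representation K (Field.absoluteGaloisGroup k) V) :
    smoothInvariants ρ ⊓ LinearMap.ker (ρ (geomFrob k) - 1) = ρ.invariants := by
  refine le_antisymm ?_ (le_inf (invariants_le_smoothInvariants ρ) fun v hv ↦ ?_)
  · rintro v ⟨hv, hF⟩
    simp only [SetLike.mem_coe, LinearMap.mem_ker, LinearMap.sub_apply, Module.End.one_apply,
      sub_eq_zero] at hF
    exact mem_invariants_of_mem_smoothInvariants_of_apply_eq ρ hv hF
  · rw [LinearMap.mem_ker, LinearMap.sub_apply, Module.End.one_apply, sub_eq_zero]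
    exact hv _

/-- **`V^U = smoothInvariants ρ ∩ Ker(ρ(F)^{[Γ_k:U]} − 1)`** for an open subgroup `U` of `Γ_k`, `k`
finite (no continuity): Milne's `H^{Gal(𝔽/k₁)}`, the classes fixed by the Frobenius `π₁ = π^{[k₁:k]}` of
the model over `k₁`, read inside the smooth vectors.  (`⊇`: `u ∈ U` is `Fʳ w` with `w ∈ U ∩ U_v`, and
then `Fʳ ∈ U` forces `[Γ:U] ∣ r`.) [cite: Milne2007TateFiniteFieldsAIM, §1 (H^{2r}(X, ℚ_ℓ(r))' = ⋃ H^{Gal(𝔽/k₁)})]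
[cite: SerreLocalFields1979, Ch. XIII §1] -/
theorem invariants_openSubgroup_eq_smoothInvariants_inf_ker (ρ : Representation K (Field.absoluteGaloisGroup k) V)
    (U : OpenSubgroup (Field.absoluteGaloisGroup k)) :
    Representation.invariants (ρ.comp (U : Subgroup (Field.absoluteGaloisGroup k)).subtype) =
      smoothInvariants ρ ⊓
        LinearMap.ker (ρ (geomFrob k) ^ (U : Subgroup (Field.absoluteGaloisGroup k)).index - 1) := by
  ext v
  simp only [Submodule.mem_inf, LinearMap.mem_ker, LinearMap.sub_apply, Module.End.one_apply,
    sub_eq_zero, Representation.mem_invariants, MonoidHom.coe_comp, Function.comp_apply,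
    Subgroup.coe_subtype]
  constructor
  · intro hv
    have hv' : ∀ u ∈ (U : Subgroup (Field.absoluteGaloisGroup k)), ρ u v = v := fun u hu ↦ hv ⟨u, hu⟩
    refine ⟨(mem_smoothInvariants_iff ρ v).mpr ⟨U, hv'⟩, ?_⟩
    rw [← map_pow]
    exact hv' _ (pow_index_mem_of_openSubgroup U _)
  · rintro ⟨hv, hF⟩ ⟨u, hu⟩
    dsimp only
    obtain ⟨U', hU'⟩ := (mem_smoothInvariants_iff ρ v).mp hv
    obtain ⟨r, -, w, hw, rfl⟩ := exists_pow_geomFrob_mul_mem (U ⊓ U') u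
    have hwU : w ∈ (U : Subgroup (Field.absoluteGaloisGroup k)) := (OpenSubgroup.mem_inf.mp hw).1
    have hwU' : w ∈ U' := (OpenSubgroup.mem_inf.mp hw).2
    have hFr : geomFrob k ^ r ∈ (U : Subgroup (Field.absoluteGaloisGroup k)) := by
      have h := (U : Subgroup (Field.absoluteGaloisGroup k)).mul_mem hu
        ((U : Subgroup (Field.absoluteGaloisGroup k)).inv_mem hwU)
      rwa [mul_inv_cancel_right] at h
    obtain ⟨m, hm⟩ := (geomFrob_pow_mem_iff_index_dvd U r).mp hFr
    rw [map_mul, Module.End.mul_apply, hU' w hwU', map_pow, hm, pow_mul, Module.End.pow_apply]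
    exact Function.IsFixedPt.iterate hF m

/-- **`Γ_k` acts on `V^U` through the finite cyclic group generated by the Frobenius**: every `ρ(g)`
agrees on `V^U` with `ρ(F)^r` for some `0 ≤ r < [Γ_k : U]` (`U` open, `k` finite, no continuity).
[cite: Milne2007TateFiniteFieldsAIM, §1] [cite: SerreLocalFields1979, Ch. XIII §1] -/
theorem exists_lt_index_forall_apply_eq_pow_apply
    (ρ : Representation K (Field.absoluteGaloisGroup k) V)
    (U : OpenSubgroup (Field.absoluteGaloisGroup k)) (g : Field.absoluteGaloisGroup k) :
    ∃ r < (U : Subgroup (Field.absoluteGaloisGroup k)).index,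
      ∀ v ∈ Representation.invariants (ρ.comp (U : Subgroup (Field.absoluteGaloisGroup k)).subtype),
        ρ g v = (ρ (geomFrob k) ^ r) v := by
  obtain ⟨r, hr, u, hu, rfl⟩ := exists_pow_geomFrob_mul_mem U g
  refine ⟨r, hr, fun v hv ↦ ?_⟩
  have huv : ρ u v = v := hv ⟨u, hu⟩
  rw [map_mul, Module.End.mul_apply, huv, map_pow]

/-- On `V^U` every `ρ(g)^{[Γ_k : U]}` is the identity (`g^{[Γ:U]} ∈ U`, `U` open, `k` finite).
[cite: SerreLocalFields1979, Ch. XIII §1] [cite: Milne2007TateFiniteFieldsAIM, §1] -/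
theorem pow_index_apply_eq_of_mem_invariants (ρ : Representation K (Field.absoluteGaloisGroup k) V)
    (U : OpenSubgroup (Field.absoluteGaloisGroup k)) (g : Field.absoluteGaloisGroup k) {v : V}
    (hv : v ∈ Representation.invariants (ρ.comp (U : Subgroup (Field.absoluteGaloisGroup k)).subtype)) :
    (ρ g ^ (U : Subgroup (Field.absoluteGaloisGroup k)).index) v = v := by
  rw [← map_pow]
  exact hv ⟨_, pow_index_mem_of_openSubgroup U g⟩

/-- **Every `ρ(g)` is a semisimple endomorphism of any `ρ(g)`-stable subspace `T ≤ V^U`** (`U` open,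
`k` finite, char `K` = 0, no continuity): `ρ(g)^{[Γ:U]} = 1` on `T` and `X^{[Γ:U]} − 1` is separable
(tree `TracePow.isSemisimple_of_pow_eq_one`, Maschke for a cyclic group).
[cite: Milne2007TateFiniteFieldsAIM, §1 Conjecture S^r] [cite: SerreLocalFields1979, Ch. XIII §1] -/
theorem isSemisimple_restrict_of_le_invariants [CharZero K]
    (ρ : Representation K (Field.absoluteGaloisGroup k) V)
    (U : OpenSubgroup (Field.absoluteGaloisGroup k)) (g : Field.absoluteGaloisGroup k)
    {T : Submodule K V}
    (hT : T ≤ Representation.invariants (ρ.comp (U : Subgroup (Field.absoluteGaloisGroup k)).subtype))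
    (hg : ∀ v ∈ T, ρ g v ∈ T) : Module.End.IsSemisimple ((ρ g).restrict hg) := by
  have hN : ((U : Subgroup (Field.absoluteGaloisGroup k)).index : K) ≠ 0 :=
    Nat.cast_ne_zero.mpr (index_ne_zero_of_openSubgroup U)
  refine Literature.RepresentationTheory.FiniteGroups.TracePow.isSemisimple_of_pow_eq_one hN ?_
  rw [Module.End.pow_restrict]
  ext ⟨v, hv⟩
  rw [LinearMap.coe_restrict_apply, Module.End.one_apply]
  exact pow_index_apply_eq_of_mem_invariants ρ U g (hT hv)

end Representations

/-! ## §3 The Tate classes: one open subgroup, and the Frobenius -/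

namespace GaloisWeilCohomology

variable {k : Type u} [Field k] {K : Type v} [Field K] [CharZero K]
  {χ : Field.absoluteGaloisGroup k →* Kˣ} (E : GaloisWeilCohomology k K χ)
variable {d : ℕ} {X : SchemeOver k}

/-- **The Tate classes are `Γ_k`-stable**: `χ(g)ᵖ ρ(g)` maps `𝒯ᵖ(X)` into itself (any field `k`; the
conjugate of an open subgroup is open). [cite: Tate1994, §1] -/
theorem ρTwist_apply_mem_tateClasses (X : SchemeOver k) (p : ℕ) (g : Field.absoluteGaloisGroup k)
    {x : E.obj X (2 * p)} (hx : x ∈ E.tateClasses X p) :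
    E.ρTwist X (2 * p) p g x ∈ E.tateClasses X p :=
  apply_mem_smoothInvariants _ g hx

/-- **ONE open subgroup fixes all Tate classes: `𝒯ᵖ(X) = H^{2p}(X)(p)^U`** for `X` smooth projective
over any field (`𝒯ᵖ(X)` is finite-dimensional: a finite spanning set, each generator fixed by an open
subgroup, and a finite intersection of open subgroups is open) — Milne's «`H^{2r}(X, ℚ_ℓ(r))' =
H^{2r}(X, ℚ_ℓ(r))^{Gal(𝔽/k₁)}` for `k₁` large». [cite: Milne2007TateFiniteFieldsAIM, §1]
[cite: Tate1994, §1] -/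
theorem exists_openSubgroup_tateClasses_eq_invariants (hX : IsSmoothProjective d X) (p : ℕ) :
    ∃ U : OpenSubgroup (Field.absoluteGaloisGroup k),
      E.tateClasses X p =
        Representation.invariants
          ((E.ρTwist X (2 * p) p).comp (U : Subgroup (Field.absoluteGaloisGroup k)).subtype) := by
  classical
  haveI := E.finite_obj hX (2 * p)
  obtain ⟨s, hs⟩ := (Submodule.fg_iff_finiteDimensional _).mpr
    (inferInstance : FiniteDimensional K (E.tateClasses X p))
  have hgen : ∀ x ∈ s, ∃ U : OpenSubgroup (Field.absoluteGaloisGroup k), ∀ g ∈ U,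
      E.ρTwist X (2 * p) p g x = x := fun x hx ↦ by
    have hx' : x ∈ E.tateClasses X p := hs ▸ Submodule.subset_span hx
    exact (mem_smoothInvariants_iff _ x).mp hx'
  choose! U hU using hgen
  refine ⟨s.inf U, le_antisymm ?_ ?_⟩
  · rw [← hs, Submodule.span_le]
    intro x hx
    simp only [SetLike.mem_coe, Representation.mem_invariants]
    rintro ⟨g, hg⟩
    exact hU x hx g ((Finset.inf_le hx : s.inf U ≤ U x) hg)
  · intro x hx
    refine (mem_smoothInvariants_iff _ x).mpr ⟨s.inf U, fun g hg ↦ ?_⟩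
    exact hx ⟨g, hg⟩

variable [Finite k]

/-- **`𝒯ᵖ(X) ∩ Ker(φ_p − 1) = H^{2p}(X)(p)^Γ`**, `φ_p = χ(F)ᵖ F` the twisted geometric Frobenius, `k`
finite, NO continuity: a Tate class fixed by the Frobenius is Galois invariant.  (The two halves of
«`H^Γ = Ker(φ − 1)`» that hold for the abstract theory: `⊆` everywhere, `⊇` on the Tate classes.)
[cite: Milne2007TateFiniteFieldsAIM, §1] [cite: Tate1994, §1] -/
theorem tateClasses_inf_ker_sub_one_eq_invariants (X : SchemeOver k) (p : ℕ) :
    E.tateClasses X p ⊓ LinearMap.ker (E.ρTwist X (2 * p) p (geomFrob k) - 1) =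
      (E.ρTwist X (2 * p) p).invariants :=
  smoothInvariants_inf_ker_sub_one_eq_invariants _

/-- `x ∈ H^{2p}(X)(p)^Γ ⟺ x` is a Tate class with `φ_p x = x` (`k` finite).
[cite: Milne2007TateFiniteFieldsAIM, §1] [cite: Tate1994, §1] -/
theorem mem_invariants_iff_mem_tateClasses_and_apply_eq (X : SchemeOver k) (p : ℕ)
    (x : E.obj X (2 * p)) :
    x ∈ (E.ρTwist X (2 * p) p).invariants ↔
      x ∈ E.tateClasses X p ∧ E.ρTwist X (2 * p) p (geomFrob k) x = x := by
  rw [← E.tateClasses_inf_ker_sub_one_eq_invariants X p, Submodule.mem_inf, LinearMap.mem_ker,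
    LinearMap.sub_apply, Module.End.one_apply, sub_eq_zero]

/-- **`T^p(X)` ⟺ `K·Aᵖ(X) = 𝒯ᵖ(X) ∩ Ker(φ_p − 1)`**: over a finite field the tree's Tate conjecture
(`K·Aᵖ(X) = H^Γ`) is «the Tate classes fixed by the Frobenius of the model are spanned by algebraic
classes» (Milne's reading of `T^r` for the model `X/k`). [cite: Milne2007TateFiniteFieldsAIM, §1 Conjecture T^r(X, ℓ) and the following paragraph]
[cite: Tate1994, §1 Conjecture T^p] -/
theorem tateConjectureFor_iff_algebraicClasses_eq_tateClasses_inf_ker (X : SchemeOver k) (p : ℕ) :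
    E.TateConjectureFor X p ↔
      E.algebraicClasses X p =
        E.tateClasses X p ⊓ LinearMap.ker (E.ρTwist X (2 * p) p (geomFrob k) - 1) := by
  rw [TateConjectureFor, tateClasses_inf_ker_sub_one_eq_invariants]

/-- **`T^p(X)` ⟺ every Tate class fixed by `φ_p` is algebraic** (`X` smooth projective over a finite
field; the inclusion `K·Aᵖ(X) ⊆ H^Γ` is the tree's `algebraicClasses_le_invariants`).
[cite: Milne2007TateFiniteFieldsAIM, §1 Conjecture T^r(X, ℓ)] [cite: Tate1994, §1 Conjecture T^p] -/
theorem tateConjectureFor_iff_forall_mem_tateClasses (hX : IsSmoothProjective d X) (p : ℕ) :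
    E.TateConjectureFor X p ↔
      ∀ x ∈ E.tateClasses X p, E.ρTwist X (2 * p) p (geomFrob k) x = x →
        x ∈ E.algebraicClasses X p := by
  constructor
  · intro hT x hx hF
    rw [hT]
    exact (E.mem_invariants_iff_mem_tateClasses_and_apply_eq X p x).mpr ⟨hx, hF⟩
  · intro h
    refine le_antisymm (E.algebraicClasses_le_invariants hX p) fun x hx ↦ ?_
    obtain ⟨hx₁, hx₂⟩ := (E.mem_invariants_iff_mem_tateClasses_and_apply_eq X p x).mp hx
    exact h x hx₁ hx₂

/-- **`H^{2p}(X)(p)^U = 𝒯ᵖ(X) ∩ Ker(φ_p^{[Γ_k:U]} − 1)`** for every open subgroup `U` (`k` finite): the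
classes fixed by `Gal(k̄/k₁)`, `[k₁ : k] = N`, are the Tate classes fixed by the Frobenius `φ_p^N` of the
model over `k₁`. [cite: Milne2007TateFiniteFieldsAIM, §1 (definition of H^{2r}(X, ℚ_ℓ(r))')] [cite: Tate1994, §1] -/
theorem invariants_openSubgroup_eq_tateClasses_inf_ker (X : SchemeOver k) (p : ℕ)
    (U : OpenSubgroup (Field.absoluteGaloisGroup k)) :
    Representation.invariants
          ((E.ρTwist X (2 * p) p).comp (U : Subgroup (Field.absoluteGaloisGroup k)).subtype) =
      E.tateClasses X p ⊓
        LinearMap.ker (E.ρTwist X (2 * p) p (geomFrob k) ^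
          (U : Subgroup (Field.absoluteGaloisGroup k)).index - 1) :=
  invariants_openSubgroup_eq_smoothInvariants_inf_ker _ U

/-- **`Γ_k` acts on `𝒯ᵖ(X)` through the finite cyclic group generated by the Frobenius** (`X` smooth
projective over a finite field, no continuity): there is `N ≥ 1` with `φ_p^N = 1` on `𝒯ᵖ(X)` and such
that every `χ(g)ᵖρ(g)` coincides on `𝒯ᵖ(X)` with `φ_p^r` for some `r < N`.
[cite: Milne2007TateFiniteFieldsAIM, §1] [cite: Tate1994, §1] [cite: SerreLocalFields1979, Ch. XIII §1] -/
theorem exists_forall_ρTwist_apply_eq_pow_apply (hX : IsSmoothProjective d X) (p : ℕ) :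
    ∃ N : ℕ, 0 < N ∧
      (∀ x ∈ E.tateClasses X p, (E.ρTwist X (2 * p) p (geomFrob k) ^ N) x = x) ∧
      ∀ g : Field.absoluteGaloisGroup k, ∃ r < N, ∀ x ∈ E.tateClasses X p,
        E.ρTwist X (2 * p) p g x = (E.ρTwist X (2 * p) p (geomFrob k) ^ r) x := by
  obtain ⟨U, hU⟩ := E.exists_openSubgroup_tateClasses_eq_invariants hX p
  refine ⟨(U : Subgroup (Field.absoluteGaloisGroup k)).index,
    Nat.pos_of_ne_zero (index_ne_zero_of_openSubgroup U), fun x hx ↦ ?_, fun g ↦ ?_⟩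
  · exact pow_index_apply_eq_of_mem_invariants _ U _ (hU ▸ hx)
  · obtain ⟨r, hr, h⟩ := exists_lt_index_forall_apply_eq_pow_apply (E.ρTwist X (2 * p) p) U g
    exact ⟨r, hr, fun x hx ↦ h x (hU ▸ hx)⟩

/-! ## §4 The Frobenius is semisimple on the Tate classes: `S^p` holds on `𝒯ᵖ(X)` -/

/-- **Every `χ(g)ᵖρ(g)`, in particular the twisted Frobenius `φ_p`, is a SEMISIMPLE endomorphism of
`𝒯ᵖ(X)`** (`X` smooth projective over a finite field, char `K` = 0, no continuity): `Γ_k` acts on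
`𝒯ᵖ(X) = H^{2p}(p)^U` through the finite group `Γ_k/U`, so `ρ(g)^{[Γ:U]} = 1` there.
[cite: Milne2007TateFiniteFieldsAIM, §1 Conjecture S^r(X, ℓ)] [cite: Tate1994, §1] -/
theorem isSemisimple_restrict_ρTwist_tateClasses (hX : IsSmoothProjective d X) (p : ℕ)
    (g : Field.absoluteGaloisGroup k) :
    Module.End.IsSemisimple ((E.ρTwist X (2 * p) p g).restrict
      fun _ hx ↦ E.ρTwist_apply_mem_tateClasses X p g hx) := by
  obtain ⟨U, hU⟩ := E.exists_openSubgroup_tateClasses_eq_invariants hX p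
  exact isSemisimple_restrict_of_le_invariants _ U g hU.le _

/-- The Frobenius case: **`φ_p|𝒯ᵖ(X)` is semisimple**. [cite: Milne2007TateFiniteFieldsAIM, §1 Conjecture S^r(X, ℓ)]
[cite: Tate1994, §1] -/
theorem isSemisimple_restrict_frob_tateClasses (hX : IsSmoothProjective d X) (p : ℕ) :
    Module.End.IsSemisimple ((E.ρTwist X (2 * p) p (geomFrob k)).restrict
      fun _ hx ↦ E.ρTwist_apply_mem_tateClasses X p (geomFrob k) hx) :=
  E.isSemisimple_restrict_ρTwist_tateClasses hX p (geomFrob k)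

/-- **The eigenvalues of the twisted Frobenius on Tate classes are roots of unity**: one `N ≥ 1` with
`a^N = 1` whenever `φ_p x = a x` for a non-zero Tate class `x` (`X` smooth projective, `k` finite).
[cite: Milne2007TateFiniteFieldsAIM, §1] [cite: Tate1994, §1] -/
theorem pow_eq_one_of_apply_eq_smul_of_mem_tateClasses (hX : IsSmoothProjective d X) (p : ℕ) :
    ∃ N : ℕ, 0 < N ∧ ∀ (a : K) (x : E.obj X (2 * p)), x ∈ E.tateClasses X p → x ≠ 0 →
      E.ρTwist X (2 * p) p (geomFrob k) x = a • x → a ^ N = 1 := by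
  obtain ⟨N, hN, hfix, -⟩ := E.exists_forall_ρTwist_apply_eq_pow_apply hX p
  refine ⟨N, hN, fun a x hx hx0 ha ↦ ?_⟩
  have hpow := Literature.RepresentationTheory.FiniteGroups.TracePow.pow_apply_of_mem_eigenspace
    (E.ρTwist X (2 * p) p (geomFrob k)) a N (Module.End.mem_eigenspace_iff.mpr ha)
  rw [hfix x hx] at hpow
  have h : (a ^ N - 1) • x = 0 := by rw [sub_smul, one_smul, ← hpow, sub_self]
  rcases smul_eq_zero.mp h with h | h
  · exact sub_eq_zero.mp h
  · exact absurd h hx0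

/-- Transport of generalized eigenvectors to the restriction (private helper): for `T` stable under
`f`, the generalized eigenspace of `f|T` is the trace of that of `f`. [folklore] -/
private theorem mem_maxGenEigenspace_restrict_iff {L : Type*} [CommRing L] {W : Type*}
    [AddCommGroup W] [Module L W] (f : Module.End L W) {T : Submodule L W}
    (hT : ∀ x ∈ T, f x ∈ T) (μ : L) (x : T) :
    x ∈ Module.End.maxGenEigenspace (f.restrict hT) μ ↔ (x : W) ∈ Module.End.maxGenEigenspace f μ := by
  rw [Module.End.maxGenEigenspace, Module.End.genEigenspace_restrict, Submodule.mem_comap,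
    Submodule.subtype_apply]

/-- **Milne's `S^p` HOLDS ON THE TATE CLASSES: `𝒯ᵖ(X) ∩ H^{2p}(X)(p)₁ = H^Γ`** — a Tate class in the
generalized eigenspace `H₁ = ⋃_N Ker((φ_p − 1)^N)` of the twisted Frobenius is FIXED by `φ_p` («it acts
as `1`»), hence Galois invariant (`X` smooth projective over a finite field, char `K` = 0, no
continuity; `φ_p|𝒯` is semisimple, so its generalized eigenspace of `1` is its fixed space).
[cite: Milne2007TateFiniteFieldsAIM, §1 Conjecture S^r(X, ℓ) «acts semisimply on H^{2r}(X, ℚ_ℓ(r))₁ (i.e., it acts as 1)»]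
[cite: Tate1994, §1] -/
theorem tateClasses_inf_maxGenEigenspace_one_eq_invariants (hX : IsSmoothProjective d X) (p : ℕ) :
    E.tateClasses X p ⊓ Module.End.maxGenEigenspace (E.ρTwist X (2 * p) p (geomFrob k)) 1 =
      (E.ρTwist X (2 * p) p).invariants := by
  refine le_antisymm ?_ (le_inf (E.invariants_le_tateClasses X p)
    ((E.invariants_le_ker_sub_one p (geomFrob k)).trans fun x hx ↦
      Module.End.eigenspace_le_maxGenEigenspace (Module.End.mem_eigenspace_iff.mpr ?_)))
  · rintro x ⟨hx, h1⟩
    have hss := E.isSemisimple_restrict_frob_tateClasses hX p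
    have hx' : (⟨x, hx⟩ : E.tateClasses X p) ∈
        Module.End.maxGenEigenspace ((E.ρTwist X (2 * p) p (geomFrob k)).restrict
          fun _ hx ↦ E.ρTwist_apply_mem_tateClasses X p (geomFrob k) hx) 1 :=
      (mem_maxGenEigenspace_restrict_iff _ _ 1 _).mpr h1
    rw [Literature.LinearAlgebra.maxGenEigenspace_one_eq_ker_of_isSemisimple hss, LinearMap.mem_ker,
      LinearMap.sub_apply, Module.End.one_apply, sub_eq_zero, Subtype.ext_iff,
      LinearMap.coe_restrict_apply] at hx'
    exact (E.mem_invariants_iff_mem_tateClasses_and_apply_eq X p x).mpr ⟨hx, hx'⟩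
  · rw [LinearMap.mem_ker, LinearMap.sub_apply, Module.End.one_apply, sub_eq_zero] at hx
    rw [hx, one_smul]

/-- The same in Milne's words: **a Tate class on which `φ_p` acts unipotently is fixed by `φ_p`**
(`(φ_p − 1)^m x = 0 ⟹ φ_p x = x` for `x ∈ 𝒯ᵖ(X)`). [cite: Milne2007TateFiniteFieldsAIM, §1 Conjecture S^r(X, ℓ)]
[cite: Tate1994, §1] -/
theorem apply_eq_of_mem_tateClasses_of_pow_sub_one_apply_eq_zero (hX : IsSmoothProjective d X)
    (p : ℕ) {x : E.obj X (2 * p)} (hx : x ∈ E.tateClasses X p) {m : ℕ}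
    (hm : ((E.ρTwist X (2 * p) p (geomFrob k) - 1) ^ m) x = 0) :
    E.ρTwist X (2 * p) p (geomFrob k) x = x := by
  have h : x ∈ E.tateClasses X p ⊓ Module.End.maxGenEigenspace (E.ρTwist X (2 * p) p (geomFrob k)) 1 :=
    ⟨hx, (Module.End.mem_maxGenEigenspace (E.ρTwist X (2 * p) p (geomFrob k)) 1 x).mpr
      ⟨m, by rwa [one_smul]⟩⟩
  rw [E.tateClasses_inf_maxGenEigenspace_one_eq_invariants hX p] at h
  exact ((E.mem_invariants_iff_mem_tateClasses_and_apply_eq X p x).mp h).2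

/-- **`Ker(φ_p − 1) ∩ (φ_p − 1)𝒯ᵖ(X) = 0`**: Milne's / Kahn's form of `S` holds for the Frobenius on
the Tate classes (`X` smooth projective over a finite field, char `K` = 0; `φ_p|𝒯` semisimple and the
tree's `ker_sub_one_inf_range_eq_bot_of_isSemisimple`). [cite: Milne2007TateFiniteFieldsAIM, §1 Conjecture S^r(X, ℓ)]
[cite: Kahn2020, §6.14 p. 132 «SS ⟹ S»] -/
theorem ker_sub_one_inf_map_tateClasses_eq_bot (hX : IsSmoothProjective d X) (p : ℕ) :
    LinearMap.ker (E.ρTwist X (2 * p) p (geomFrob k) - 1) ⊓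
        (E.tateClasses X p).map (E.ρTwist X (2 * p) p (geomFrob k) - 1) = ⊥ := by
  set φ := E.ρTwist X (2 * p) p (geomFrob k) with hφ
  have hT : ∀ x ∈ E.tateClasses X p, φ x ∈ E.tateClasses X p := fun x hx ↦
    E.ρTwist_apply_mem_tateClasses X p (geomFrob k) hx
  have hss : Module.End.IsSemisimple (φ.restrict hT) := E.isSemisimple_restrict_frob_tateClasses hX p
  have hbot := Literature.LinearAlgebra.ker_sub_one_inf_range_eq_bot_of_isSemisimple hss
  refine (Submodule.eq_bot_iff _).mpr ?_
  rintro x ⟨hxk, ⟨y, hy, rfl⟩⟩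
  have hyT : (φ - 1) y ∈ E.tateClasses X p := Submodule.sub_mem _ (hT y hy) hy
  have hmem : (⟨(φ - 1) y, hyT⟩ : E.tateClasses X p) ∈
      LinearMap.ker (φ.restrict hT - 1) ⊓ LinearMap.range (φ.restrict hT - 1) := by
    refine ⟨?_, ⟨⟨y, hy⟩, ?_⟩⟩
    · rw [SetLike.mem_coe, LinearMap.mem_ker] at hxk ⊢
      rw [Subtype.ext_iff]
      simpa only [LinearMap.sub_apply, Module.End.one_apply, Submodule.coe_sub,
        LinearMap.coe_restrict_apply, Submodule.coe_zero] using hxk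
    · rw [Subtype.ext_iff]
      simp only [LinearMap.sub_apply, Module.End.one_apply, Submodule.coe_sub,
        LinearMap.coe_restrict_apply]
  rw [hbot, Submodule.mem_bot, Subtype.ext_iff, Submodule.coe_zero] at hmem
  exact hmem

end GaloisWeilCohomology

end Literature.AlgebraicGeometry.Motives

end
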